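import Literature.NumberTheory.GelbartRogawski1991.DoubledUnitaryArchSiegelDiagonal
import Literature.NumberTheory.GelbartRogawski1991.DoubledUnitaryArchSiegelModulus
import HarnessLib

/-!
# The archimedean Siegel element `(g, 1)` of the doubled unitary group on diagonal pairs: `det_ℝ A = |det_Δ (g,1)|_{𝔸_L}`
([Kudla1994, §3]; [HarrisKudlaSweet1996, §1 (1.15)]: the modulus `|x(p)|` of the Siegel-parabolic character
`χ(x(p)) |x(p)|^{1/2}` at the archimedean places; kernel construction of [GelbartRogawski1991, Prop. 3.1.1])

Topic `NumberTheory/GelbartRogawski1991`; namespace `Literature.NumberTheory.GelbartRogawski1991.GRConstruction`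
(continues `DoubledUnitaryArchSiegelDiagonal`).  KERNEL only: proved theorems; no new notion, no named fact, no `sorry`.

For `g ∈ U(J^𝔻)(L⁺ ⊗ ℝ)` with `(g, 1) ∈ P_Δ(𝔸)`: `DoubledUnitaryArchSiegelDiagonal.archAct_toSpD_diagPair` says that
`ι^𝔻(g,1)` acts on diagonal archimedean pairs through the real-linear map `A = ⊕_v Res_{ℂ/ℝ}(α_{w(v)})`
(`α = (g,1)₁₁ + (g,1)₁₂ = deltaBlock`, `w(v) = placeOver v`) with `det A = ∏_v |det α_{w(v)}|²`
(`det_archDiagAct`); `DoubledUnitaryArchSiegelModulus.ideleNorm_eq_prod_norm_det_deltaBlock_sq` says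
`|det_Δ (g,1)|_{𝔸_L} = ∏_v |det α_{w(v)}|²`.  Hence:

* `adeleMatAt_coe_archToAdelic` — `σ_w((g,1)) = g_w` (the tree's `map_placeEval_coe_archToAdelic`, restated for `adeleMatAt`);
* `modDelta_archToAdelic_sq_eq_prod_normSq` — `modDelta (g,1)² = ∏_v |det α_{w(v)}|²`;
* **`exists_archAct_diagPair_det_eq_modDelta_sq`** — a real-linear automorphism `A` of the archimedean pairs with
  `archAct (ι^𝔻 (g,1)) ((a,a),(z,z)) = (((A(a,z))₁, (A(a,z))₁), ((A(a,z))₂, (A(a,z))₂))`, `0 < det A` and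
  `det A = modDelta (g,1)²` — the input `S1arch_modulus` ∕ `stub_S1arch_archActDiag` of the archimedean half
  `IsArchHalf` of the [GR91 3.1.1] construction (stage-1 cell `pub-hodgecm`, seat GR-3; third hand `own-crow`), in
  tree vocabulary: combined with the `𝕐`-block frame lemma of that seat (`det d_p = det A` for any such `A`) it gives
  `det d_p = |det_Δ (p,1)|_{𝔸_L} > 0`.

Nothing here is a claim of the manuscripts adjudicated by that cell.

## References

* S. S. Kudla, *Splitting metaplectic covers of dual reductive pairs*, Israel J. Math. 87 (1994) 361–401, §3 [Kudla1994].
* M. Harris, S. S. Kudla, W. J. Sweet, *Theta dichotomy for unitary groups*, J. Amer. Math. Soc. 9 (1996), §1 [HarrisKudlaSweet1996].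
* S. Gelbart, J. Rogawski, Invent. Math. 105 (1991), §3.1 Prop. 3.1.1 p. 455 [GelbartRogawski1991].
* A. Borel, H. Jacquet, PSPM 33.1 (1979), §4.1 [BorelJacquet1979].
-/

set_option autoImplicit false

noncomputable section

open scoped Classical
open scoped Matrix
open NumberField NumberField.InfinitePlace NumberField.mixedEmbedding IsDedekindDomain
open Literature.NumberTheory.Automorphic Literature.NumberTheory.Automorphic.UnitaryGroup
open Literature.NumberTheory.Weil1964
open Literature.RepresentationTheory.HeisenbergGroup

namespace Literature.NumberTheory.GelbartRogawski1991.GRConstruction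

open UnitaryDualPair QuadraticCoordinates

/-! ## §5 At the archimedean element `(g, 1)`: `det_ℝ A = |det_Δ (g,1)|_{𝔸_L} = modDelta (g,1)²` -/

section Arch

variable (L : Type) [Field L] [NumberField L] [IsCMField L]
variable {N M n : ℕ} (e : Fin N × Fin M ≃ Fin n)
  (dV : Fin N → L) (hdV : ∀ i, IsCMField.complexConj L (dV i) = dV i)
  (dW : Fin M → L) (hdW : ∀ i, IsCMField.complexConj L (dW i) = dW i)

/-- `σ_w((g, 1)) = g_w`: the adelic matrix of the archimedean element read at the complex place `w` is the matrix of
the place component `archAt w g` (the tree's `map_placeEval_coe_archToAdelic`). [cite: BorelJacquet1979, §4.1] -/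
theorem adeleMatAt_coe_archToAdelic (w : {w : InfinitePlace L // w.IsComplex})
    (g : arch (Fp L) L (IsCMField.complexConj L) (n + n) (hermD L e dV hdV dW hdW)) :
    adeleMatAt L (Fin (n + n)) w
        (((UnitaryGroup.archToAdelic (Fp L) L (IsCMField.complexConj L) (n + n) (hermD L e dV hdV dW hdW) g).1 :
            GL (Fin (n + n)) (AdeleRing (𝓞 L) L)) : Matrix (Fin (n + n)) (Fin (n + n)) (AdeleRing (𝓞 L) L)) =
      (((archAt (Fp L) L (IsCMField.complexConj L) (n + n) (hermD L e dV hdV dW hdW) w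
            (complexConj_smul_infinitePlace L w.1) (IsCMField.complexConj_ne_one L) g :
          archLocal L (n + n) (hermD L e dV hdV dW hdW) w) : GL (Fin (n + n)) ℂ) : Matrix (Fin (n + n)) (Fin (n + n)) ℂ) :=
  map_placeEval_coe_archToAdelic (Fp L) L (IsCMField.complexConj L) (n + n) (hermD L e dV hdV dW hdW) w
    (complexConj_smul_infinitePlace L w.1) (IsCMField.complexConj_ne_one L) g

/-- **`modDelta (g,1)² = ∏_v |det α_{w(v)}|²`**: the idelic modulus `|det_Δ (g,1)|_{𝔸_L}` of the archimedean Siegel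
element is the product over the real places `v` of `L⁺` of `|det σ_{w(v)}(α)|²`, `α = (g,1)₁₁ + (g,1)₁₂`
(`DoubledUnitaryArchSiegelModulus.ideleNorm_eq_prod_norm_det_deltaBlock_sq`).
[cite: Kudla1994, §3] [cite: HarrisKudlaSweet1996, §1 (1.15)] -/
theorem modDelta_archToAdelic_sq_eq_prod_normSq (g : arch (Fp L) L (IsCMField.complexConj L) (n + n) (hermD L e dV hdV dW hdW))
    (hu : IsUnit (detDelta L e dV hdV dW hdW
      (UnitaryGroup.archToAdelic (Fp L) L (IsCMField.complexConj L) (n + n) (hermD L e dV hdV dW hdW) g))) :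
    modDelta L e dV hdV dW hdW
          (UnitaryGroup.archToAdelic (Fp L) L (IsCMField.complexConj L) (n + n) (hermD L e dV hdV dW hdW) g) ^ 2 =
      ∏ v : {v : InfinitePlace (Fp L) // v.IsReal},
        Complex.normSq (adeleMatAt L (Fin n) (placeOver L v) (deltaBlock L e dV hdV dW hdW
          (UnitaryGroup.archToAdelic (Fp L) L (IsCMField.complexConj L) (n + n) (hermD L e dV hdV dW hdW) g))).det := by
  have hmod := UnitaryDualPair.ArchSplitting.ideleNorm_eq_prod_norm_det_deltaBlock_sq L (hermD L e dV hdV dW hdW)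
    (IsCMField.complexConj_ne_one L) (placeOver L) (fun v => complexConj_smul_infinitePlace L (placeOver L v).1)
    (placeOver_comap L) g hu.unit (by rw [IsUnit.unit_spec]; rfl)
  have hv : ∀ v : {v : InfinitePlace (Fp L) // v.IsReal},
      ‖((Matrix.reindex finSumFinEquiv.symm finSumFinEquiv.symm
            (((archAt (Fp L) L (IsCMField.complexConj L) (n + n) (hermD L e dV hdV dW hdW) (placeOver L v)
                (complexConj_smul_infinitePlace L (placeOver L v).1) (IsCMField.complexConj_ne_one L) g :
              archLocal L (n + n) (hermD L e dV hdV dW hdW) (placeOver L v)) : GL (Fin (n + n)) ℂ) :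
                Matrix (Fin (n + n)) (Fin (n + n)) ℂ)).toBlocks₁₁ +
          (Matrix.reindex finSumFinEquiv.symm finSumFinEquiv.symm
            (((archAt (Fp L) L (IsCMField.complexConj L) (n + n) (hermD L e dV hdV dW hdW) (placeOver L v)
                (complexConj_smul_infinitePlace L (placeOver L v).1) (IsCMField.complexConj_ne_one L) g :
              archLocal L (n + n) (hermD L e dV hdV dW hdW) (placeOver L v)) : GL (Fin (n + n)) ℂ) :
                Matrix (Fin (n + n)) (Fin (n + n)) ℂ)).toBlocks₁₂).det‖ ^ 2 =
        Complex.normSq (adeleMatAt L (Fin n) (placeOver L v) (deltaBlock L e dV hdV dW hdW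
          (UnitaryGroup.archToAdelic (Fp L) L (IsCMField.complexConj L) (n + n) (hermD L e dV hdV dW hdW) g))).det := by
    intro v
    rw [← adeleMatAt_coe_archToAdelic, Complex.normSq_eq_norm_sq]
    unfold adeleMatAt
    rw [blocks₁_map_eq_deltaBlock_map]
  unfold modDelta
  rw [dif_pos hu, hmod, Real.sq_sqrt (Finset.prod_nonneg fun v _ => by positivity)]
  exact Finset.prod_congr rfl fun v _ => hv v

/-- **The archimedean Siegel parabolic acts on the diagonal through `Res(α)`, with `det_ℝ = |det_Δ|_{𝔸_L}`.**  For
`g ∈ U(J^𝔻)(L⁺ ⊗ ℝ)` with `(g, 1) ∈ P_Δ(𝔸)` (and `det_Δ (g,1)` a unit, automatic on `P_Δ`) there is a real-linear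
automorphism `A` of the archimedean pairs `(a, z) ∈ (L⁺ ⊗ ℝ)ⁿ × (L⁺ ⊗ ℝ)ⁿ` such that `ι^𝔻(g, 1)` maps the diagonal pair
of `(a, z)` to the diagonal pair of `A (a, z)`, `0 < det A`, and `det A = |det_Δ (g,1)|_{𝔸_L} = modDelta (g,1)²`
(`A = ⊕_v Res_{ℂ/ℝ}(α_{w(v)})`, `det A = ∏_v |det α_{w(v)}|²`).  This is the `det` part of the Siegel-parabolic character
`χ(det_Δ p)|det_Δ p|^{1/2}` at the archimedean places ([HarrisKudlaSweet1996, §1 (1.15)], `m = 1`).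
[cite: Kudla1994, §3] [cite: HarrisKudlaSweet1996, §1 (1.15)] [cite: GelbartRogawski1991, §3.1 Prop. 3.1.1 p. 455 L1–2] -/
theorem exists_archAct_diagPair_det_eq_modDelta_sq
    (g : arch (Fp L) L (IsCMField.complexConj L) (n + n) (hermD L e dV hdV dW hdW))
    (hS : IsSiegelDelta L e dV hdV dW hdW
      (UnitaryGroup.archToAdelic (Fp L) L (IsCMField.complexConj L) (n + n) (hermD L e dV hdV dW hdW) g))
    (hu : IsUnit (detDelta L e dV hdV dW hdW
      (UnitaryGroup.archToAdelic (Fp L) L (IsCMField.complexConj L) (n + n) (hermD L e dV hdV dW hdW) g))) :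
    ∃ A : ((Fin n → mixedSpace (Fp L)) × (Fin n → mixedSpace (Fp L))) ≃ₗ[ℝ]
        ((Fin n → mixedSpace (Fp L)) × (Fin n → mixedSpace (Fp L))),
      (∀ az : (Fin n → mixedSpace (Fp L)) × (Fin n → mixedSpace (Fp L)),
        archAct (gramDA L e dV hdV dW hdW)
            (toSpD L e dV hdV dW hdW
              (UnitaryGroup.archToAdelic (Fp L) L (IsCMField.complexConj L) (n + n) (hermD L e dV hdV dW hdW) g))
            (Sum.elim az.1 az.1 ∘ ⇑(e₂ (n := n)).symm, Sum.elim az.2 az.2 ∘ ⇑(e₂ (n := n)).symm) =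
          (Sum.elim (A az).1 (A az).1 ∘ ⇑(e₂ (n := n)).symm, Sum.elim (A az).2 (A az).2 ∘ ⇑(e₂ (n := n)).symm)) ∧
      0 < LinearMap.det (A : ((Fin n → mixedSpace (Fp L)) × (Fin n → mixedSpace (Fp L))) →ₗ[ℝ]
        ((Fin n → mixedSpace (Fp L)) × (Fin n → mixedSpace (Fp L)))) ∧
      ((LinearMap.det (A : ((Fin n → mixedSpace (Fp L)) × (Fin n → mixedSpace (Fp L))) →ₗ[ℝ]
          ((Fin n → mixedSpace (Fp L)) × (Fin n → mixedSpace (Fp L)))) : ℝ) : ℂ) =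
        ((modDelta L e dV hdV dW hdW
          (UnitaryGroup.archToAdelic (Fp L) L (IsCMField.complexConj L) (n + n) (hermD L e dV hdV dW hdW) g) : ℝ) : ℂ) ^ 2 := by
  set p := UnitaryGroup.archToAdelic (Fp L) L (IsCMField.complexConj L) (n + n) (hermD L e dV hdV dW hdW) g with hp
  have hdetw : ∀ w : {w : InfinitePlace L // w.IsComplex},
      (adeleMatAt L (Fin n) w (deltaBlock L e dV hdV dW hdW p)).det ≠ 0 := by
    intro w
    have h1 : (adeleMatAt L (Fin n) w (deltaBlock L e dV hdV dW hdW p)).det = adeleAt L w (detDelta L e dV hdV dW hdW p) := by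
      unfold adeleMatAt detDelta
      rw [RingHom.map_det, RingHom.mapMatrix_apply]
    rw [h1]
    exact (hu.map (adeleAt L w)).ne_zero
  have hdet := det_archDiagAct L e dV hdV dW hdW p
  have hpos : 0 < LinearMap.det (archDiagAct L e dV hdV dW hdW p) := by
    rw [hdet]
    exact Finset.prod_pos fun v _ => Complex.normSq_pos.2 (hdetw _)
  have hU : IsUnit (archDiagAct L e dV hdV dW hdW p) :=
    (LinearMap.isUnit_iff_isUnit_det _).2 (isUnit_iff_ne_zero.2 hpos.ne')
  refine ⟨LinearMap.GeneralLinearGroup.generalLinearEquiv ℝ _ hU.unit, fun az => ?_, ?_, ?_⟩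
  · have hA : (LinearMap.GeneralLinearGroup.generalLinearEquiv ℝ _ hU.unit) az = archDiagAct L e dV hdV dW hdW p az := rfl
    rw [hA]
    exact archAct_toSpD_diagPair L e dV hdV dW hdW p hS az
  · rw [LinearMap.GeneralLinearGroup.generalLinearEquiv_to_linearMap, IsUnit.unit_spec]
    exact hpos
  · rw [LinearMap.GeneralLinearGroup.generalLinearEquiv_to_linearMap, IsUnit.unit_spec, hdet, ← Complex.ofReal_pow,
      modDelta_archToAdelic_sq_eq_prod_normSq L e dV hdV dW hdW g hu]

end Arch

end Literature.NumberTheory.GelbartRogawski1991.GRConstruction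

end
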